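import Literature.NumberTheory.EllipticCurves.BSDRankZeroFamilyRootNumberProofs
import HarnessLib

/-!
# Bhargava–Shankar, Thm 4 (`pos_proportion_rank_zero`): the fact split into its three printed inputs

Topic `Literature/NumberTheory/EllipticCurves`. Pure composition (no definition, no new named fact):
the SPLIT RECORD (fact-decompose, 2026-08-16) of the named fact
`Literature.NumberTheory.EllipticCurves.pos_proportion_rank_zero` (`BSDWave0.lean`, bsd.S26:
M. Bhargava, A. Shankar, *Ternary cubic forms having bounded invariants, and the existence of a
positive proportion of elliptic curves having rank 0*, Ann. of Math. (2) 181 (2015) 587–621 =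
arXiv:1007.0052v2, Thm 4: "a positive proportion of elliptic curves over `ℚ`, ordered by height, have
rank `0`"). Its printed proof (§4.1–4.2, proof of Thm 41) combines exactly three theorems, each a
named fact of the tree:

1. `heightAverageOn_card_selmerThree_le_four` — Thm 27 (average size of the `3`-Selmer group in a
   large family is `≤ 4`; `BSDRankZeroDensity.lean`), the deep input (the ternary-cubic-forms
   counting, §§2–3 of the source);
2. `even_selmerRank_sub_torsionRank_iff` — Thm 42 (Dokchitser–Dokchitser `p`-parity,
   `BSDRankZeroDensity.lean`);
3. `ModularForms.exists_isNewformOf` — the Modularity Theorem (`CuspFormLFunction.lean`), which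
   supplies the root-number input "`ω(E) = −ω(E₋₁)` on the family `F` of §4.1"
   (`rootNumber_negB_of_isBSFamily_of_exists_isNewformOf`, `BSDRankZeroFamilyRootNumberProofs.lean`,
   replacing the source's appeal to S. Wong's local computation at `2`).

Everything else of the printed proof — the construction of the §4.1 family and its positive
density (Thm 37), "`50%` root number `+1`", Lemma 19 (rational `3`-torsion is negligible), and the
counting "at least `25%` of the curves in `F` with root number `+1` have trivial `3`-Selmer group,
hence rank `0`" — is PROVED in the tree (`BSDRankZeroDensity`, `BSDRankZeroSieve`,
`BSDRankZeroFamily`, `BSDRankZeroFamilyRootNumberProofs`), assembled as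
`pos_proportion_rank_zero_of_facts₂'`. This file records that assembly in the standard split shape
`pos_proportion_rank_zero_holds_of : Child₁ → Child₂ → Child₃ → pos_proportion_rank_zero`, so that
provers are pointed at the three children (of which only Thm 27 is specific to this paper).

## References

* [BhargavaShankarTernary2015] M. Bhargava, A. Shankar, Ann. of Math. (2) 181 (2015) 587–621 =
  arXiv:1007.0052v2: Thm 4, Thm 27, Thm 37, Thm 41 and its proof, Thm 42, §4.1.
* [DokchitserDokchitserAnnals2010] T. Dokchitser, V. Dokchitser, Ann. of Math. 172 (2010), Thm 1.4.
* [DiamondShurman2005] F. Diamond, J. Shurman, *A First Course in Modular Forms*, Thm. 8.8.3.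
-/

namespace Literature.NumberTheory.EllipticCurves

/-- **Split of `pos_proportion_rank_zero` (Bhargava–Shankar, Thm 4) into its three printed inputs**:
Thm 27 (`heightAverageOn_card_selmerThree_le_four`), Thm 42 (Dokchitser–Dokchitser,
`even_selmerRank_sub_torsionRank_iff`) and the Modularity Theorem
(`ModularForms.exists_isNewformOf`, for the root numbers of the §4.1 family) imply that a positive
proportion of elliptic curves over `ℚ`, ordered by naive height, have Mordell–Weil rank `0`. The
assembly is the tree's `pos_proportion_rank_zero_of_facts₂'` (proof of Thm 41 with the §4.1
family). [cite: BhargavaShankarTernary2015, Thm 4 and proof of Thm 41 with §4.1 (arXiv v2 numbering)] -/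
theorem pos_proportion_rank_zero_holds_of
    (h27 : heightAverageOn_card_selmerThree_le_four)
    (h42 : even_selmerRank_sub_torsionRank_iff)
    (hmod : ModularForms.exists_isNewformOf) :
    pos_proportion_rank_zero :=
  pos_proportion_rank_zero_of_facts₂' h27 h42 hmod

end Literature.NumberTheory.EllipticCurves
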